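import Mathlib
import Literature.Probability.MarkovChains.MetropolisHastings
import Literature.Probability.MarkovChains.TotalVariation
import Literature.Probability.Entropy.BinaryRelativeEntropy
import Literature.InformationTheory.Entropy.GibbsInequality
import Summits.Ventures.LatticeQCDFlow.Exactness.FlowMCMC
import Summits.Ventures.LatticeQCDFlow.Exactness.JarzynskiFinite
import Summits.Ventures.LatticeQCDFlow.Scaling.ImportanceWeights
import Summits.Ventures.LatticeQCDFlow.Scaling.SectorBudget
import Summits.Ventures.LatticeQCDFlow.Scaling.BlockDefect
import Summits.Ventures.LatticeQCDFlow.Scaling.StochasticFlows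
import Summits.Ventures.LatticeQCDFlow.Scaling.StochasticBudgets
import Summits.Ventures.LatticeQCDFlow.Scaling.VarianceLaws

/-!
# LatticeQCDFlow / Scaling — variance laws II: the reweighting window for Gibbs laws (T2-AA), the
# two-sided annealing step law (T2-AC), the Jeffreys identity along a protocol (T2-AD), the
# annealing WORK law (T2-AE)

HONEST FRAMING: exact (Metropolis-corrected) sampling algorithms for lattice gauge theory;
figures of merit are autocorrelation/cost numbers at stated couplings and volumes; no
continuum-physics claim.

Venture `LatticeQCDFlow` (cell pub-lqcd), topic `Scaling`, THEORY-2.md §3.7 / §4 T2-AA/AC/AD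
(v1.7) and T2-AE (v1.8), prepared for landing by the theory seat (FANOUT row 29) from
`HOME/THEORY-2-Sketch.lean` v1.8, rebased on the tree's `Exactness/JarzynskiFinite` (`gibbsLaw`,
`partitionFn`), `Scaling/StochasticFlows` (`gibbsLaw_pos`, `sum_gibbsLaw`, `revPathLaw`),
`Scaling/StochasticBudgets` (`ess_perfect_relaxation`, T2-W) and `Scaling/VarianceLaws`
(`varLaw`, `logW`, `varLaw_logW_le_chiSq`, `chiSq_le_exp_mul_varLaw`, `klFin_add_klFin`).

* `logW_gibbs`, `varLaw_logW_gibbs`: between Gibbs laws the log-weight is the ACTION DIFFERENCE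
  up to a constant; **T2-AA** `varLaw_step_le_chiSq`, `ess_step_le`
  (`ESS(p_j, p_k) ≤ 1/(1 + Var_{p_j}(S_k − S_j))` — the Ferrenberg–Swendsen REWEIGHTING WINDOW
  `|Δβ| ≲ 1/√(Var A) ∝ V^{−1/2}` as a theorem), `chiSq_step_le`; **T2-AD** `jeffreys_gibbs`.
* **T2-AC** (annealing step law, both sides; `prod_essFrac_le_inv`, `prod_ess_linProtocol_le`,
  `nsteps_linProtocol_ge`, `prod_essFrac_ge_exp`): for a Jarzynski / NE-MCMC protocol
  `S_0, …, S_n` with PERFECTLY relaxing layers (`ÊSS = Π_k ESS(p_{k+1}, p_k)`),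
  `Π_k ESS ≤ 1/(1 + Σ_k Var_{k+1}(S_{k+1} − S_k))`; for ANY linear protocol `S_k = β_k A`
  (`linProtocol`) with `Var_{β_k}(A) ≥ σ²` along the path, `≤ 1/(1 + σ²(β_n − β_0)²/n)`, i.e.
  `n_step ≥ σ²(Δβ)²·ÊSS/(1 − ÊSS)` — LINEAR IN THE VOLUME at fixed ÊSS when `σ² = c_A·V` (the
  printed `n_step ∝ n_dof` law of arXiv:2510.25704 §4 / arXiv:2412.00200, derived rather than
  assumed); conversely `Π_k ESS ≥ exp(−e^{M} Σ_k Var_k)` when each step's action increment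
  oscillates by `≤ M`: `log(1/ÊSS) ≍ (Δβ)²·Var(A)/n` exactly in order.
* **T2-AE** (annealing WORK law, v1.8; `work_linProtocol_ge`): if every step costs at least `c·V`
  units of work and `Var_{β_k}(A) ≥ a·V`, the work `W = n·c·V` of one weighted path obeys
  `η·a·c·V²(β_n − β_0)² ≤ (1 − η)·W` at path-ESS fraction `≥ η` — work per effective sample
  `Ω(V²)` at fixed ÊSS and coupling interval (the printed "`δt ∼ 1/V`, `O(V)` steps, `O(V²)`
  effort" heuristic, Abbott MIT PhD thesis 2025 §3.7 eq. (3.158), as a theorem OF THE MODEL).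
* **T2-AC on path space** (`ess_perfect_relaxation_le_inv`, `ess_perfect_relaxation_linProtocol_le`,
  `ess_perfect_relaxation_ge_exp`): the same bounds for the NE-MCMC path ESS `ÊSS` via the tree's
  `ess_perfect_relaxation`.

Elementary (`[folklore]`-level); farm `lean check` rc 0, no `sorry`.
-/

namespace Summit.Ventures.LatticeQCDFlow.Theory2

open Finset
open Literature.Probability.MarkovChains
open Summit.Ventures.LatticeQCDFlow.Exactness

variable {X : Type*} [Fintype X]

/-! ### T2-AA/AC/AD for Gibbs laws: reweighting window and the annealing step law -/

section GibbsVariance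

variable {n : ℕ}

/-- The log-weight between two Gibbs laws of a protocol is the action difference up to a
constant: `log(p_j/p_k) = (S_k − S_j) + log(Z_k/Z_j)`. -/
theorem logW_gibbs [Nonempty X] (S : Fin (n+1) → X → ℝ) (j k : Fin (n+1)) (x : X) :
    logW (gibbsLaw (S j)) (gibbsLaw (S k)) x =
      (S k x - S j x) + (Real.log (partitionFn (S k)) - Real.log (partitionFn (S j))) := by
  unfold logW
  rw [Real.log_div (gibbsLaw_pos (S j) x).ne' (gibbsLaw_pos (S k) x).ne']
  unfold gibbsLaw
  rw [Real.log_div (Real.exp_pos _).ne' (partitionFn_pos (S j)).ne',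
    Real.log_div (Real.exp_pos _).ne' (partitionFn_pos (S k)).ne', Real.log_exp, Real.log_exp]
  ring

/-- For two Gibbs laws the log-weight variance is the variance of the ACTION DIFFERENCE:
`Var_{p_j}(log(p_j/p_k)) = Var_{p_j}(S_k − S_j)`. [folklore] -/
theorem varLaw_logW_gibbs [Nonempty X] (S : Fin (n+1) → X → ℝ) (j k : Fin (n+1)) :
    varLaw (gibbsLaw (S j)) (logW (gibbsLaw (S j)) (gibbsLaw (S k))) =
      varLaw (gibbsLaw (S j)) (fun x => S k x - S j x) :=
  varLaw_congr_pair (sum_gibbsLaw (S j)) fun x y => by rw [logW_gibbs, logW_gibbs]; ring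

/-- **T2-AA for Gibbs laws (reweighting / annealing step; proved).**
`Var_{p_j}(S_k − S_j) ≤ χ²(p_j ‖ p_k) = 1/ESS(p_j, p_k) − 1`: reweighting samples of `e^{−S_k}`
to the target `e^{−S_j}` has `ESS ≤ 1/(1 + Var_{target}(ΔS))`.  For `S_k = βA`,
`S_j = (β + h)A`: `ESS ≤ 1/(1 + h²·Var_{β+h}(A))` — the reweighting window is
`|h| ≤ √((1/ESS − 1)/Var A) ∝ V^{−1/2}` for an extensive action. [folklore] -/
theorem varLaw_step_le_chiSq [Nonempty X] (S : Fin (n+1) → X → ℝ) (j k : Fin (n+1)) :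
    varLaw (gibbsLaw (S j)) (fun x => S k x - S j x) ≤ (essFrac (gibbsLaw (S j)) (gibbsLaw (S k)))⁻¹ - 1 := by
  rw [← varLaw_logW_gibbs]
  exact varLaw_logW_le_chiSq (gibbsLaw_pos (S j)) (gibbsLaw_pos (S k)) (sum_gibbsLaw (S j)) (sum_gibbsLaw (S k))

/-- **T2-AA for Gibbs laws (reweighting window; proved).**  `ESS(p_j, p_k) ≤ 1/(1 + Var_{p_j}(S_k − S_j))`:
the Ferrenberg–Swendsen window `|Δβ| ≲ 1/√(Var A)` as a theorem. [folklore] -/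
theorem ess_step_le [Nonempty X] (S : Fin (n+1) → X → ℝ) (j k : Fin (n+1)) :
    essFrac (gibbsLaw (S j)) (gibbsLaw (S k)) ≤ (1 + varLaw (gibbsLaw (S j)) (fun x => S k x - S j x))⁻¹ := by
  rw [← varLaw_logW_gibbs]
  exact essFrac_le_inv_one_add_varLaw (gibbsLaw_pos (S j)) (gibbsLaw_pos (S k)) (sum_gibbsLaw (S j))
    (sum_gibbsLaw (S k))

/-- Converse: `χ²(p_j‖p_k) ≤ e^{M}·Var_{p_j}(S_k − S_j)` when the action increment oscillates by
at most `M` over configurations. -/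
theorem chiSq_step_le [Nonempty X] (S : Fin (n+1) → X → ℝ) (j k : Fin (n+1)) {M : ℝ}
    (hM : ∀ x y, |(S k x - S j x) - (S k y - S j y)| ≤ M) :
    (essFrac (gibbsLaw (S j)) (gibbsLaw (S k)))⁻¹ - 1 ≤
      Real.exp M * varLaw (gibbsLaw (S j)) (fun x => S k x - S j x) := by
  rw [← varLaw_logW_gibbs]
  refine chiSq_le_exp_mul_varLaw (gibbsLaw_pos (S j)) (gibbsLaw_pos (S k)) (sum_gibbsLaw (S j))
    (sum_gibbsLaw (S k)) fun x y => ?_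
  rw [logW_gibbs, logW_gibbs]
  rw [show S k x - S j x + (Real.log (partitionFn (S k)) - Real.log (partitionFn (S j))) -
      (S k y - S j y + (Real.log (partitionFn (S k)) - Real.log (partitionFn (S j))))
      = (S k x - S j x) - (S k y - S j y) by ring]
  exact hM x y

/-- **T2-AD for Gibbs laws.**  `D(p_j‖p_k) + D(p_k‖p_j) = E_{p_k}(S_j − S_k) − E_{p_j}(S_j − S_k)`
(`= Σ (p_j − p_k)(S_k − S_j)`); for `S_k = βA`, `S_j = (β+h)A` this is
`h(⟨A⟩_β − ⟨A⟩_{β+h}) ≥ 0`. [folklore] -/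
theorem jeffreys_gibbs [Nonempty X] (S : Fin (n+1) → X → ℝ) (j k : Fin (n+1)) :
    klFin (gibbsLaw (S j)) (gibbsLaw (S k)) + klFin (gibbsLaw (S k)) (gibbsLaw (S j)) =
      ∑ x, (gibbsLaw (S j) x - gibbsLaw (S k) x) * (S k x - S j x) := by
  rw [klFin_add_klFin (gibbsLaw (S j)) (gibbsLaw (S k))]
  simp_rw [logW_gibbs S j k, mul_add]
  rw [sum_add_distrib, ← sum_mul, sum_sub_distrib, sum_gibbsLaw, sum_gibbsLaw, sub_self, zero_mul,
    add_zero]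

/-- **T2-AC (annealing step law, necessity; proved).**  With perfectly relaxing layers the
NE-MCMC / Jarzynski reweighting ESS is `Π_k ESS(p_{k+1}, p_k)` (T2-W `ess_perfect_relaxation`),
and that product is at most `1/(1 + Σ_k Var_{p_{k+1}}(S_{k+1} − S_k))`. [folklore] -/
theorem prod_essFrac_le_inv [Nonempty X] (S : Fin (n+1) → X → ℝ) :
    ∏ k : Fin n, essFrac (gibbsLaw (S k.succ)) (gibbsLaw (S k.castSucc)) ≤
      (1 + ∑ k : Fin n, varLaw (gibbsLaw (S k.succ)) (fun x => S k.castSucc x - S k.succ x))⁻¹ := by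
  have hσ : ∀ k : Fin n, 0 ≤ varLaw (gibbsLaw (S k.succ)) (fun x => S k.castSucc x - S k.succ x) :=
    fun k => varLaw_nonneg (fun x => (gibbsLaw_pos (S _) x).le) (sum_gibbsLaw (S _)) _
  calc ∏ k : Fin n, essFrac (gibbsLaw (S k.succ)) (gibbsLaw (S k.castSucc))
      ≤ ∏ k : Fin n, (1 + varLaw (gibbsLaw (S k.succ)) (fun x => S k.castSucc x - S k.succ x))⁻¹ :=
        prod_le_prod (fun k _ => essFrac_nonneg fun x => (gibbsLaw_pos (S _) x).le)
          fun k _ => ess_step_le S _ _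
    _ = (∏ k : Fin n, (1 + varLaw (gibbsLaw (S k.succ)) (fun x => S k.castSucc x - S k.succ x)))⁻¹ :=
        by rw [prod_inv_distrib]
    _ ≤ _ := inv_anti₀ (by linarith [sum_nonneg fun k (_ : k ∈ (univ : Finset (Fin n))) => hσ k])
          (one_add_sum_le_prod_one_add _ fun k _ => hσ k)

/-- **T2-AC (annealing step law, sufficiency; proved).**  If each step's action increment
oscillates by at most `M`, then `Π_k ESS(p_{k+1}, p_k) ≥ exp(−e^{M} Σ_k Var_{k+1}(ΔS_k))`. -/
theorem prod_essFrac_ge_exp [Nonempty X] (S : Fin (n+1) → X → ℝ) {M : ℝ}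
    (hM : ∀ (k : Fin n) x y,
      |(S k.castSucc x - S k.succ x) - (S k.castSucc y - S k.succ y)| ≤ M) :
    Real.exp (-(Real.exp M *
        ∑ k : Fin n, varLaw (gibbsLaw (S k.succ)) (fun x => S k.castSucc x - S k.succ x))) ≤
      ∏ k : Fin n, essFrac (gibbsLaw (S k.succ)) (gibbsLaw (S k.castSucc)) := by
  rw [mul_sum, ← sum_neg_distrib, Real.exp_sum]
  refine prod_le_prod (fun k _ => (Real.exp_pos _).le) fun k _ => ?_
  have hE : 0 < essFrac (gibbsLaw (S k.succ)) (gibbsLaw (S k.castSucc)) :=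
    essFrac_pos (gibbsLaw_pos (S _)) (sum_gibbsLaw (S _))
  have hχ := chiSq_step_le S k.succ k.castSucc (hM k)
  have hexp := Real.add_one_le_exp (Real.exp M *
    varLaw (gibbsLaw (S k.succ)) (fun x => S k.castSucc x - S k.succ x))
  -- 1/ESS ≤ 1 + e^M Var ≤ exp(e^M Var), hence exp(−e^M Var) ≤ ESS
  have h1 : (essFrac (gibbsLaw (S k.succ)) (gibbsLaw (S k.castSucc)))⁻¹ ≤
      Real.exp (Real.exp M * varLaw (gibbsLaw (S k.succ)) (fun x => S k.castSucc x - S k.succ x)) := by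
    linarith
  rw [Real.exp_neg]
  rw [inv_le_comm₀ (Real.exp_pos _) hE]
  exact h1

/-- Linear (β-)protocol `S_k = β_k · A`, `k = 0, …, n`. -/
noncomputable def linProtocol (β : ℕ → ℝ) (A : X → ℝ) (n : ℕ) : Fin (n+1) → X → ℝ :=
  fun k x => β k * A x

omit [Fintype X] in
/-- Consecutive increments of the linear protocol: `S_k − S_{k+1} = (β_k − β_{k+1})·A`. -/
theorem linProtocol_step (β : ℕ → ℝ) (A : X → ℝ) (n : ℕ) (k : Fin n) (x : X) :
    linProtocol β A n k.castSucc x - linProtocol β A n k.succ x = (β k - β (k + 1)) * A x := by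
  simp only [linProtocol, Fin.val_castSucc, Fin.val_succ]; ring

/-- **T2-AC for a linear protocol (proved).**  For ANY `β_0, …, β_n` and perfectly relaxing
layers, if the action variance along the path is `≥ σ² ≥ 0`, then
`Π_k ESS(p_{k+1}, p_k) ≤ 1/(1 + σ²(β_n − β_0)²/n)` (Cauchy–Schwarz over the steps: uneven
steps do not help). [folklore] -/
theorem prod_ess_linProtocol_le [Nonempty X] (β : ℕ → ℝ) (A : X → ℝ) (n : ℕ) {σ2 : ℝ}
    (hσ0 : 0 ≤ σ2) (hσ : ∀ k : Fin n, σ2 ≤ varLaw (gibbsLaw (linProtocol β A n k.succ)) A) :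
    ∏ k : Fin n, essFrac (gibbsLaw (linProtocol β A n k.succ))
        (gibbsLaw (linProtocol β A n k.castSucc)) ≤ (1 + σ2 * (β n - β 0) ^ 2 / n)⁻¹ := by
  have h1 := prod_essFrac_le_inv (linProtocol β A n)
  have hstep : ∀ k : Fin n, varLaw (gibbsLaw (linProtocol β A n k.succ))
      (fun x => linProtocol β A n k.castSucc x - linProtocol β A n k.succ x)
      = (β k - β (k + 1)) ^ 2 * varLaw (gibbsLaw (linProtocol β A n k.succ)) A := by
    intro k
    rw [show (fun x => linProtocol β A n k.castSucc x - linProtocol β A n k.succ x) =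
        fun x => (β k - β (k + 1)) * A x from funext fun x => linProtocol_step β A n k x]
    exact varLaw_const_mul (sum_gibbsLaw _) _ _
  simp_rw [hstep] at h1
  have hsum_sq : (∑ k : Fin n, (β (k + 1) - β k)) ^ 2 ≤
      n * ∑ k : Fin n, (β (k + 1) - β k) ^ 2 := by
    have := sq_sum_le_card_mul_sum_sq (s := (univ : Finset (Fin n)))
      (f := fun k : Fin n => β (k + 1) - β k)
    simpa [Finset.card_univ, Fintype.card_fin] using this
  have htel : ∑ k : Fin n, (β (k + 1) - β k) = β n - β 0 :=
    (Fin.sum_univ_eq_sum_range (fun i => β (i + 1) - β i) n).trans (Finset.sum_range_sub β n)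
  have hn : σ2 * (β n - β 0) ^ 2 / n ≤
      ∑ k : Fin n, (β k - β (k + 1)) ^ 2 * varLaw (gibbsLaw (linProtocol β A n k.succ)) A := by
    rcases Nat.eq_zero_or_pos n with hn0 | hnpos
    · subst hn0; simp
    have hn' : (0:ℝ) < n := Nat.cast_pos.mpr hnpos
    calc σ2 * (β n - β 0) ^ 2 / n ≤ σ2 * ∑ k : Fin n, (β (k + 1) - β k) ^ 2 := by
          rw [div_le_iff₀ hn', ← htel]
          nlinarith [mul_le_mul_of_nonneg_left hsum_sq hσ0]
      _ = ∑ k : Fin n, (β k - β (k + 1)) ^ 2 * σ2 := by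
          rw [mul_sum]; exact sum_congr rfl fun k _ => by ring
      _ ≤ _ := sum_le_sum fun k _ => mul_le_mul_of_nonneg_left (hσ k) (sq_nonneg _)
  have hpos : 0 < 1 + σ2 * (β n - β 0) ^ 2 / n := by
    have : 0 ≤ σ2 * (β n - β 0) ^ 2 / n := by positivity
    linarith
  exact h1.trans (inv_anti₀ hpos (by linarith))

/-- **T2-AC (step count; proved).**  At reweighting ESS `≥ η` the number of protocol steps obeys
`n ≥ σ²(β_n − β_0)²·η/(1 − η)` — linear in the volume when `σ² ∝ V`. -/
theorem nsteps_linProtocol_ge [Nonempty X] (β : ℕ → ℝ) (A : X → ℝ) (n : ℕ) {σ2 η : ℝ}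
    (hσ0 : 0 ≤ σ2) (hσ : ∀ k : Fin n, σ2 ≤ varLaw (gibbsLaw (linProtocol β A n k.succ)) A)
    (hη : η ≤ ∏ k : Fin n, essFrac (gibbsLaw (linProtocol β A n k.succ))
        (gibbsLaw (linProtocol β A n k.castSucc))) :
    η * (σ2 * (β n - β 0) ^ 2) ≤ (1 - η) * n := by
  have h := hη.trans (prod_ess_linProtocol_le β A n hσ0 hσ)
  have hu : 0 ≤ σ2 * (β n - β 0) ^ 2 / n := by positivity
  have hpos : 0 < 1 + σ2 * (β n - β 0) ^ 2 / n := by linarith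
  have h2 : η * (1 + σ2 * (β n - β 0) ^ 2 / n) ≤ 1 := by
    have := mul_le_mul_of_nonneg_right h hpos.le
    rwa [inv_mul_cancel₀ hpos.ne'] at this
  rcases Nat.eq_zero_or_pos n with hn0 | hnpos
  · subst hn0; simp
  have hn' : (0:ℝ) < n := Nat.cast_pos.mpr hnpos
  have h3 : η * (σ2 * (β n - β 0) ^ 2) / n ≤ 1 - η := by
    rw [mul_div_assoc]; linarith
  rwa [div_le_iff₀ hn'] at h3

/-- **T2-AE (annealing WORK law; corollary of T2-AC, v1.8).**  In the perfect-relaxation model with a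
linear protocol `S_k = β_k • A` (any schedule), suppose every step costs at least `c * V` units of work
(one sweep of a volume-`V` lattice, `0 ≤ c`), the stepwise variance of `A` is extensive,
`a * V ≤ Var_{p_{k+1}} A` for every step (`0 ≤ a`; for the Wilson action: a positive specific heat per
plaquette uniformly in the volume — a physics input, not supplied here), and the path ESS
fraction is at least `η`.  Then the total work `W = n * (c * V)` of one weighted path obeys
`η * a * c * V² * (β_n − β_0)² ≤ (1 − η) * W`: WORK PER PATH, hence per effective sample, is `Ω(V²)`
at fixed `ÊSS` and fixed coupling interval.  This is the printed heuristic "`δt ∼ 1/V`, `O(V)` steps,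
`O(V²)` effort for annealing with perfect mixing kernels" (Abbott, MIT PhD thesis 2025, §3.7
eq. (3.158); Bonanno–Bulgarelli–Cellini–Nada–Panfalone–Vadacchino–Verzichelli 2026, `n_step ∝ V`)
as a theorem OF THE MODEL; it is not a bound for imperfectly relaxing kernels in either direction
(Abbott's annealed-HMC fit `O(V^{23/12})` lies below it by trading relaxation for cheaper steps). -/
theorem work_linProtocol_ge [Nonempty X] (β : ℕ → ℝ) (A : X → ℝ) (n : ℕ) {a c V η : ℝ}
    (ha : 0 ≤ a) (hc : 0 ≤ c) (hV : 0 ≤ V)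
    (hσ : ∀ k : Fin n, a * V ≤ varLaw (gibbsLaw (linProtocol β A n k.succ)) A)
    (hη : η ≤ ∏ k : Fin n, essFrac (gibbsLaw (linProtocol β A n k.succ))
        (gibbsLaw (linProtocol β A n k.castSucc))) :
    η * (a * c * V ^ 2 * (β n - β 0) ^ 2) ≤ (1 - η) * (n * (c * V)) := by
  have h := nsteps_linProtocol_ge β A n (σ2 := a * V) (mul_nonneg ha hV) hσ hη
  have hcV : 0 ≤ c * V := mul_nonneg hc hV
  have h' := mul_le_mul_of_nonneg_right h hcV
  calc η * (a * c * V ^ 2 * (β n - β 0) ^ 2)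
        = η * (a * V * (β n - β 0) ^ 2) * (c * V) := by ring
    _ ≤ (1 - η) * n * (c * V) := h'
    _ = (1 - η) * (n * (c * V)) := by ring

end GibbsVariance

/-! ### T2-AC on path space (with T2-W `ess_perfect_relaxation`) -/

section AnnealingPath

variable {n : ℕ}

/-- **T2-AC on path space (proved).**  NE-MCMC / Jarzynski flow with perfectly relaxing layers:
`ÊSS ≤ 1/(1 + Σ_k Var_{p_{k+1}}(S_{k+1} − S_k))`. -/
theorem ess_perfect_relaxation_le_inv [Nonempty X] [DecidableEq X] (S : Fin (n+1) → X → ℝ) :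
    essFrac (revPathLaw S (fun k _ y => gibbsLaw (S k.succ) y))
        (pathLaw (gibbsLaw (S 0)) (fun k _ y => gibbsLaw (S k.succ) y)) ≤
      (1 + ∑ k : Fin n, varLaw (gibbsLaw (S k.succ)) (fun x => S k.castSucc x - S k.succ x))⁻¹ := by
  rw [ess_perfect_relaxation]; exact prod_essFrac_le_inv S

/-- **T2-AC on path space, linear protocol, any schedule (proved).**
`ÊSS ≤ 1/(1 + σ²(β_N − β_0)²/N)`. -/
theorem ess_perfect_relaxation_linProtocol_le [Nonempty X] [DecidableEq X] (β : ℕ → ℝ)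
    (A : X → ℝ) (N : ℕ) {σ2 : ℝ} (hσ0 : 0 ≤ σ2)
    (hσ : ∀ k : Fin N, σ2 ≤ varLaw (gibbsLaw (linProtocol β A N k.succ)) A) :
    essFrac (revPathLaw (linProtocol β A N) (fun k _ y => gibbsLaw (linProtocol β A N k.succ) y))
        (pathLaw (gibbsLaw (linProtocol β A N 0)) (fun k _ y => gibbsLaw (linProtocol β A N k.succ) y))
      ≤ (1 + σ2 * (β N - β 0) ^ 2 / N)⁻¹ := by
  rw [ess_perfect_relaxation]; exact prod_ess_linProtocol_le β A N hσ0 hσ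

/-- **T2-AC on path space, sufficiency (proved).**  Bounded increments:
`ÊSS ≥ exp(−e^{M} Σ_k Var_{k+1}(ΔS_k))`. -/
theorem ess_perfect_relaxation_ge_exp [Nonempty X] [DecidableEq X] (S : Fin (n+1) → X → ℝ)
    {M : ℝ} (hM : ∀ (k : Fin n) x y,
      |(S k.castSucc x - S k.succ x) - (S k.castSucc y - S k.succ y)| ≤ M) :
    Real.exp (-(Real.exp M *
        ∑ k : Fin n, varLaw (gibbsLaw (S k.succ)) (fun x => S k.castSucc x - S k.succ x))) ≤
      essFrac (revPathLaw S (fun k _ y => gibbsLaw (S k.succ) y))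
        (pathLaw (gibbsLaw (S 0)) (fun k _ y => gibbsLaw (S k.succ) y)) := by
  rw [ess_perfect_relaxation]; exact prod_essFrac_ge_exp S hM

end AnnealingPath

end Summit.Ventures.LatticeQCDFlow.Theory2
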